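import Summits.KontsevichZagierPeriods.Zeta5Search.TwoTaleOmega.OmegaKit
import Summits.KontsevichZagierPeriods.Zeta5Search.TwoTaleOmega.OmegaStepKit

/-!
# (bmiss)@Ω — instance kit B: the region `Ω`, the hinge data on `Ω` in closed form, nodes and contour windows
(cell `pub-zeta5`, cert-1 gen 4)

HONEST FRAMING: systematic search; recurrence certificates; no irrationality claim unless certified. Pure finite algebra
over `ℚ`/`ℤ`; no named fact.

OUR infrastructure (Summit side) shared by the per-direction instances of the Ω-recurrence (blueprint
`families/tele/RECURRENCE.md` §13.10–13.12; fam-tele's `OmegaForms`/`OmegaKit`):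
* `Pt.Omega p` — fam-tele gen 3's admissible region Ω (`certs/tele/bmiss_general/PROOF.md` §0) as named inequalities,
  and its consequences: first-tale WEAK admissibility, second-tale admissibility (always), `Admissible` when `d ≥ 0`;
* the hinge data on ALL of Ω: `Pt.vL_eval_w`, `Pt.vL_natDegree_le_w`, and the closed form `Pt.vL_eq_ofFrac :
  vL p = ofFrac [a,g) 1 num` (Lemma U), whence `rho1_vL_zero`, `rho0_vL_zero`, the node-move lemma `Pt.lam_vL_move`
  and the `t`-shift `Pt.vL_shift` of the first-tale integrand (the Γ-ratio `tn/td` shared by all directions);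
* the order statistics at a point of the family in omega-ready form: `a2star_t1a_eq : a₂*(e,f,b,a) = median(e,f,b)`,
  `amax_t1a_eq`, `t2_ranges`, `a0star_t2a_eq`, and the DOUBLE-ZERO WINDOW `sq_lin_dvd_num`: for
  `a − max(e,f) + 1 ≤ c < a₂*` two numerator blocks contain `c` (this is [Zudilin 2014, (P4)]'s contour window, made finite);
* projection simp lemmas for the lattice moves `addA/addB/addE/addF/addG`.
-/

noncomputable section

open Finset Polynomial
open Literature.NumberTheory.Irrationality.Zudilin2014
open Summit.KontsevichZagierPeriods.Zeta5Search.FormalBarnes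

namespace Summit.KontsevichZagierPeriods.Zeta5Search.TwoTaleOmega

namespace Pt

variable (p : Pt)


/-! ### Coordinates of the moved points (projection lemmas; keep `p.addB k` folded elsewhere) -/

/-- The `a`-coordinate of `p.addB k`. -/
@[simp] theorem addB_a (k : ℤ) : (p.addB k).a = p.a := rfl
/-- The `b`-coordinate of `p.addB k`. -/
@[simp] theorem addB_b (k : ℤ) : (p.addB k).b = p.b + k := rfl
/-- The `e`-coordinate of `p.addB k`. -/
@[simp] theorem addB_e (k : ℤ) : (p.addB k).e = p.e := rfl
/-- The `f`-coordinate of `p.addB k`. -/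
@[simp] theorem addB_f (k : ℤ) : (p.addB k).f = p.f := rfl
/-- The `g`-coordinate of `p.addB k`. -/
@[simp] theorem addB_g (k : ℤ) : (p.addB k).g = p.g := rfl
/-- The `a`-coordinate of `p.addG k`. -/
@[simp] theorem addG_a (k : ℤ) : (p.addG k).a = p.a := rfl
/-- The `b`-coordinate of `p.addG k`. -/
@[simp] theorem addG_b (k : ℤ) : (p.addG k).b = p.b := rfl
/-- The `e`-coordinate of `p.addG k`. -/
@[simp] theorem addG_e (k : ℤ) : (p.addG k).e = p.e := rfl
/-- The `f`-coordinate of `p.addG k`. -/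
@[simp] theorem addG_f (k : ℤ) : (p.addG k).f = p.f := rfl
/-- The `g`-coordinate of `p.addG k`. -/
@[simp] theorem addG_g (k : ℤ) : (p.addG k).g = p.g + k := rfl
/-- The `a`-coordinate of `p.addE k`. -/
@[simp] theorem addE_a (k : ℤ) : (p.addE k).a = p.a := rfl
/-- The `b`-coordinate of `p.addE k`. -/
@[simp] theorem addE_b (k : ℤ) : (p.addE k).b = p.b := rfl
/-- The `e`-coordinate of `p.addE k`. -/
@[simp] theorem addE_e (k : ℤ) : (p.addE k).e = p.e + k := rfl
/-- The `f`-coordinate of `p.addE k`. -/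
@[simp] theorem addE_f (k : ℤ) : (p.addE k).f = p.f := rfl
/-- The `g`-coordinate of `p.addE k`. -/
@[simp] theorem addE_g (k : ℤ) : (p.addE k).g = p.g := rfl
/-- The `a`-coordinate of `p.addF k`. -/
@[simp] theorem addF_a (k : ℤ) : (p.addF k).a = p.a := rfl
/-- The `b`-coordinate of `p.addF k`. -/
@[simp] theorem addF_b (k : ℤ) : (p.addF k).b = p.b := rfl
/-- The `e`-coordinate of `p.addF k`. -/
@[simp] theorem addF_e (k : ℤ) : (p.addF k).e = p.e := rfl
/-- The `f`-coordinate of `p.addF k`. -/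
@[simp] theorem addF_f (k : ℤ) : (p.addF k).f = p.f + k := rfl
/-- The `g`-coordinate of `p.addF k`. -/
@[simp] theorem addF_g (k : ℤ) : (p.addF k).g = p.g := rfl
/-- The `a`-coordinate of `p.addA k`. -/
@[simp] theorem addA_a (k : ℤ) : (p.addA k).a = p.a + k := rfl
/-- The `b`-coordinate of `p.addA k`. -/
@[simp] theorem addA_b (k : ℤ) : (p.addA k).b = p.b := rfl
/-- The `e`-coordinate of `p.addA k`. -/
@[simp] theorem addA_e (k : ℤ) : (p.addA k).e = p.e := rfl
/-- The `f`-coordinate of `p.addA k`. -/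
@[simp] theorem addA_f (k : ℤ) : (p.addA k).f = p.f := rfl
/-- The `g`-coordinate of `p.addA k`. -/
@[simp] theorem addA_g (k : ℤ) : (p.addA k).g = p.g := rfl

/-! ### The region Ω -/

/-- **fam-tele's admissible region `Ω`** (`certs/tele/bmiss_general/PROOF.md` §0), in the letters `p = (a,b,e,f,g)`:
`2e ≥ a+1`, `2f ≥ a+1`, `e ≤ a`, `f ≤ a`, `2max(e,f) ≥ a+3`, `b ≥ a − min(e,f) + 1`, `g ≥ max(a,b)+1`, `g ≥ b+3`,
`g ≤ 2e+2f+b−a−1` (all coordinates are then `≥ 1`). -/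
structure Omega : Prop where
  /-- `a + 1 ≤ 2e` -/
  twoE : p.a + 1 ≤ 2 * p.e
  /-- `a + 1 ≤ 2f` -/
  twoF : p.a + 1 ≤ 2 * p.f
  /-- `e ≤ a` -/
  e_le : p.e ≤ p.a
  /-- `f ≤ a` -/
  f_le : p.f ≤ p.a
  /-- `a + 3 ≤ 2 max(e,f)` -/
  maxEF : p.a + 3 ≤ 2 * max p.e p.f
  /-- `a − min(e,f) + 1 ≤ b` -/
  b_ge : p.a - min p.e p.f + 1 ≤ p.b
  /-- `a + 1 ≤ g` -/
  a_lt_g : p.a + 1 ≤ p.g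
  /-- `b + 3 ≤ g` -/
  b3_le_g : p.b + 3 ≤ p.g
  /-- `g ≤ 2e + 2f + b − a − 1` -/
  g_le : p.g ≤ 2 * p.e + 2 * p.f + p.b - p.a - 1

variable {p}

/-- All coordinates of a point of Ω are `≥ 1` (and `a ≥ 3`). -/
theorem Omega.pos (h : p.Omega) : 3 ≤ p.a ∧ 1 ≤ p.b ∧ 2 ≤ p.e ∧ 2 ≤ p.f ∧ 4 ≤ p.g := by
  obtain ⟨h1, h2, h3, h4, h5, h6, h7, h8, h9⟩ := h
  refine ⟨?_, ?_, ?_, ?_, ?_⟩ <;> omega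

/-- The entries of `t1a p = (e,f,b,a)`. -/
theorem t1a_apply : p.t1a 0 = p.e ∧ p.t1a 1 = p.f ∧ p.t1a 2 = p.b ∧ p.t1a 3 = p.a := ⟨rfl, rfl, rfl, rfl⟩
/-- The entries of `t1b p = (1, a−e+1, a−f+1, g)`. -/
theorem t1b_apply : p.t1b 0 = 1 ∧ p.t1b 1 = p.a - p.e + 1 ∧ p.t1b 2 = p.a - p.f + 1 ∧ p.t1b 3 = p.g :=
  ⟨rfl, rfl, rfl, rfl⟩
/-- The entries of `t2a p = (g−b+a; f, e, a)`. -/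
theorem t2a_apply : p.t2a 0 = p.g - p.b + p.a ∧ p.t2a 1 = p.f ∧ p.t2a 2 = p.e ∧ p.t2a 3 = p.a := ⟨rfl, rfl, rfl, rfl⟩
/-- The entries of `t2b p = (a+1; a−b+1, e+f, g)`. -/
theorem t2b_apply : p.t2b 0 = p.a + 1 ∧ p.t2b 1 = p.a - p.b + 1 ∧ p.t2b 2 = p.e + p.f ∧ p.t2b 3 = p.g :=
  ⟨rfl, rfl, rfl, rfl⟩

/-- On Ω the first-tale data are weakly admissible (everything of (cond1) except possibly `d ≥ 0`). -/
theorem Omega.admissibleW (h : p.Omega) : AdmissibleW p.t1a p.t1b := by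
  obtain ⟨h1, h2, h3, h4, h5, h6, h7, h8, h9⟩ := h
  constructor
  · intro j hj i
    fin_cases j <;> fin_cases i <;> simp [t1a, t1b] at hj ⊢ <;> omega
  · intro i
    fin_cases i <;> simp [t1a, t1b] <;> omega

/-- On Ω with `d ≥ 0` the first-tale data are admissible. -/
theorem Omega.admissible (h : p.Omega) (hd : 0 ≤ p.dInt) : Admissible p.t1a p.t1b where
  lower := h.admissibleW.lower
  upper := h.admissibleW.upper
  balance := by rw [← sub_nonneg, sum_t1a_sub_sum_t1b]; exact hd

/-- On Ω the second-tale data are admissible (eq. (cond2); the balance `Σ â + 2 = Σ b̂` is an identity of the family). -/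
theorem Omega.admissibleT (h : p.Omega) : AdmissibleT p.t2a p.t2b := by
  obtain ⟨h1, h2, h3, h4, h5, h6, h7, h8, h9⟩ := h
  refine ⟨?_, ?_, ?_, ?_, ?_, ?_, ?_⟩
  · simp [t2a, t2b]; omega
  · intro j hj; fin_cases j <;> simp [t2a, t2b] at hj ⊢ <;> omega
  · simp [t2a, t2b]; omega
  · intro j hj; fin_cases j <;> simp [t2a, t2b] at hj ⊢ <;> omega
  · simp [t2a, t2b]; omega
  · intro j hj; fin_cases j <;> simp [t2a, t2b] at hj ⊢ <;> omega
  · simp [t2a, t2b, Fin.sum_univ_four]; ring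

/-! ### The hinge data on Ω: values and degree, balance-free -/

/-- `vL p` evaluates to `num(t)/den(t)` off the poles `t = −k`, `a ≤ k < g`, for EVERY `p ∈ Ω`. -/
theorem vL_eval_w (h : p.Omega) {t : ℚ} (ht : ∀ k ∈ Ico p.a p.g, t + k ≠ 0) :
    p.vL.eval t = (num p.t1a p.t1b).eval t / (den p.t1a p.t1b).eval t := by
  unfold vL
  rw [PF.eval_smul, dataR_eval_w h.admissibleW ht]
  unfold R
  have hP := Pi_ne_zero p
  simp only [Pt.Pi] at hP ⊢
  rw [← mul_div_assoc, inv_mul_cancel_left₀ hP]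

/-- Degree bound of the polynomial part of `vL p` on all of Ω. -/
theorem vL_natDegree_le_w (h : p.Omega) : p.vL.poly.natDegree ≤ dExp p.t1a p.t1b :=
  (natDegree_C_mul_le _ _).trans (natDegree_polyP_le_w h.admissibleW)

/-- `vR p` evaluates to `ε_p Π(p)⁻¹ R̂(u/2)` off the poles, for every `p ∈ Ω`. -/
theorem vR_eval_w (h : p.Omega) {u : ℚ} (hu : (denT p.t2a p.t2b).eval (u / 2) ≠ 0) :
    p.vR.eval u = p.eps * (p.Pi)⁻¹ * RT p.t2a p.t2b (u / 2) := vR_eval p h.admissibleT hu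



/-- `a₄*(e,f,b,a) = max(e,f,b,a)`. -/
theorem amax_t1a_eq : amax p.t1a = max (max p.e p.f) (max p.b p.a) := rfl

/-! ### The first-tale hinge data as closed-form data -/

/-- `num(t1a p, t1b p) = block(1,e)·block(a−e+1,f)·block(a−f+1,b)`. -/
theorem num_t1 : num p.t1a p.t1b = block 1 p.e * block (p.a - p.e + 1) p.f * block (p.a - p.f + 1) p.b := rfl

/-- `den(t1a p, t1b p) = block(a,g)`. -/
theorem den_t1 : den p.t1a p.t1b = block p.a p.g := rfl

/-- **`vL p` in closed form**: on Ω, `vL p = ofFrac (num) [a,g) 1` (Lemma U). -/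
theorem vL_eq_ofFrac (h : p.Omega) : p.vL = PF.ofFrac (Ico p.a p.g) (fun _ => 1) (num p.t1a p.t1b) := by
  refine PF.eq_of_eval_eq_on _ _ (Ico p.a p.g) ?_ (PF.poles_ofFrac _ _ _) fun t ht => ?_
  · refine (poles_vL p).trans (Ico_subset_Ico ?_ le_rfl)
    rw [amax_t1a_eq]; have := h.e_le; have := h.f_le; omega
  · rw [vL_eval_w h ht, PF.eval_ofFrac _ _ _ (fun _ _ => Or.inl rfl) ht, denom_Ico_one, den_t1]

/-- `ρ¹` of `vL p` vanishes at every node `s` with `−s < a` (no pole there). -/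
theorem rho1_vL_zero (h : p.Omega) {c : ℤ} (hc : c < p.a) : rho1 (-c) p.vL = 0 := by
  rw [vL_eq_ofFrac h]; exact PF.rho1_ofFrac_eq_zero _ _ _ (by simp [mem_Ico]; omega)

/-- `ρ⁰` of `vL p` vanishes at `t = −c`, `c < a`, as soon as `(X+c)²` divides the numerator (double zero). -/
theorem rho0_vL_zero (h : p.Omega) {c : ℤ} (hc : c < p.a) (hdvd : lin c ^ 2 ∣ num p.t1a p.t1b) :
    rho0 (-c) p.vL = 0 := by
  rw [vL_eq_ofFrac h]
  exact PF.rho0_ofFrac_eq_zero _ _ _ (fun _ _ => Or.inl rfl) (by simp [mem_Ico]; omega) hdvd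

/-- Moving the first-tale node of `vL p` to the right across double zeros: `Λ_{s+n}[vL] = Λ_s[vL]` whenever
`(X + (−s−i))² ∣ num` for `i < n` and the crossed points stay left of `−a`… i.e. `−s − i < a`. -/
theorem lam_vL_move (h : p.Omega) (s : ℤ) (n : ℕ) (d : ℕ) (hd : p.vL.poly.natDegree ≤ d) (ha : -s < p.a)
    (hdvd : ∀ i : ℕ, i < n → lin (-(s + i)) ^ 2 ∣ num p.t1a p.t1b) :
    lam0 d (s + n) p.vL = lam0 d s p.vL ∧ lam1 (s + n) p.vL = lam1 s p.vL := by
  refine ⟨lam0_move_eq d s p.vL hd n fun i hi => ?_, lam1_move_eq s p.vL n fun i hi => ?_⟩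
  · have := rho0_vL_zero h (c := -(s + i)) (by omega) (hdvd i hi); rwa [neg_neg] at this
  · have := rho1_vL_zero h (c := -(s + i)) (by omega); rwa [neg_neg] at this


/-- **The `t`-shift of the first-tale integrand**: `F_L(p;t+1)·(t+1)(t+a−e+1)(t+a−f+1)(t+g) = F_L(p;t)·(t+e)(t+f)(t+b)(t+a)`
(the four block shift laws; `t`, `t+1` off the poles). Shared by every direction. -/
theorem vL_shift (h : p.Omega) {t : ℚ} (ht : ∀ k ∈ Ico p.a p.g, t + k ≠ 0) (ht1 : ∀ k ∈ Ico p.a p.g, t + 1 + k ≠ 0) :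
    p.vL.eval (t + 1) * ((t + 1) * (t + (p.a - p.e + 1 : ℤ)) * (t + (p.a - p.f + 1 : ℤ)) * (t + p.g))
      = p.vL.eval t * ((t + p.e) * (t + p.f) * (t + p.b) * (t + p.a)) := by
  obtain ⟨o1, o2, o3, o4, o5, o6, o7, o8, o9⟩ := h
  have hD0 : (block p.a p.g).eval t ≠ 0 := eval_block_ne_zero fun i hi h => ht i hi (by rw [h]; ring)
  have hD1 : (block p.a p.g).eval (t + 1) ≠ 0 := eval_block_ne_zero fun i hi h => ht1 i hi (by rw [h]; ring)
  rw [vL_eval_w ⟨o1, o2, o3, o4, o5, o6, o7, o8, o9⟩ ht, vL_eval_w ⟨o1, o2, o3, o4, o5, o6, o7, o8, o9⟩ ht1, num_t1,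
    den_t1]
  simp only [eval_mul]
  rw [div_mul_eq_mul_div, div_mul_eq_mul_div, div_eq_div_iff hD1 hD0]
  have b1 := eval_block_succ_mul (lo := 1) (hi := p.e) (by omega) t
  have b2 := eval_block_succ_mul (lo := p.a - p.e + 1) (hi := p.f) (by omega) t
  have b3 := eval_block_succ_mul (lo := p.a - p.f + 1) (hi := p.b) (by omega) t
  have b4 := eval_block_succ_mul (lo := p.a) (hi := p.g) (by omega) t
  set X1 := (block 1 p.e).eval (t + 1)
  set Y1 := (block 1 p.e).eval t
  set X2 := (block (p.a - p.e + 1) p.f).eval (t + 1)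
  set Y2 := (block (p.a - p.e + 1) p.f).eval t
  set X3 := (block (p.a - p.f + 1) p.b).eval (t + 1)
  set Y3 := (block (p.a - p.f + 1) p.b).eval t
  set X4 := (block p.a p.g).eval (t + 1)
  set Y4 := (block p.a p.g).eval t
  push_cast at b1 b2 b3 b4 ⊢
  linear_combination (X2 * (t + (p.a - p.e + 1)) * X3 * (t + (p.a - p.f + 1)) * ((t + p.g) * Y4)) * b1
    + (Y1 * (t + p.e) * X3 * (t + (p.a - p.f + 1)) * ((t + p.g) * Y4)) * b2
    + (Y1 * (t + p.e) * Y2 * (t + p.f) * ((t + p.g) * Y4)) * b3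
    - (Y1 * Y2 * Y3 * (t + p.e) * (t + p.f) * (t + p.b)) * b4

/-! ### The order statistics at a point of the family, omega-ready -/

/-- `a₂*(e,f,b,a)` is the second smallest of `e,f,b,a`: linear consequences sufficient for `omega`. -/
theorem a2star_t1a_spec : min p.f (min p.b p.a) ≤ a2star p.t1a ∧ min p.e (min p.b p.a) ≤ a2star p.t1a ∧
    min p.e (min p.f p.a) ≤ a2star p.t1a ∧ min p.e (min p.f p.b) ≤ a2star p.t1a ∧
    (p.e < a2star p.t1a → a2star p.t1a ≤ p.f ∧ a2star p.t1a ≤ p.b ∧ a2star p.t1a ≤ p.a) ∧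
    (p.f < a2star p.t1a → a2star p.t1a ≤ p.e ∧ a2star p.t1a ≤ p.b ∧ a2star p.t1a ≤ p.a) ∧
    (p.b < a2star p.t1a → a2star p.t1a ≤ p.e ∧ a2star p.t1a ≤ p.f ∧ a2star p.t1a ≤ p.a) ∧
    (p.a < a2star p.t1a → a2star p.t1a ≤ p.e ∧ a2star p.t1a ≤ p.f ∧ a2star p.t1a ≤ p.b) := by
  have hm := a2star_ge_min3 p.t1a
  have h0 := a2star_le_others p.t1a 0
  have h1 := a2star_le_others p.t1a 1
  have h2 := a2star_le_others p.t1a 2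
  have h3 := a2star_le_others p.t1a 3
  simp only [t1a, Matrix.cons_val_zero, Matrix.cons_val_one, Matrix.head_cons, Matrix.cons_val_two,
    Matrix.tail_cons, Matrix.cons_val_three] at hm h0 h1 h2 h3 ⊢
  refine ⟨hm.1, hm.2.1, hm.2.2.1, hm.2.2.2, ?_, ?_, ?_, ?_⟩
  · intro h; exact ⟨h0 h 1 (by decide), h0 h 2 (by decide), h0 h 3 (by decide)⟩
  · intro h; exact ⟨h1 h 0 (by decide), h1 h 2 (by decide), h1 h 3 (by decide)⟩
  · intro h; exact ⟨h2 h 0 (by decide), h2 h 1 (by decide), h2 h 3 (by decide)⟩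
  · intro h; exact ⟨h3 h 0 (by decide), h3 h 1 (by decide), h3 h 2 (by decide)⟩
/-- **Closed form of the first-tale node index on the family**: since `e, f ≤ a` on Ω, the second smallest of
`(e,f,b,a)` is the median of `e,f,b`: `a₂*(e,f,b,a) = max(min(e,f), min(max(e,f), b))`. -/
theorem a2star_t1a_eq (h : p.Omega) : a2star p.t1a = max (min p.e p.f) (min (max p.e p.f) p.b) := by
  have sp := p.a2star_t1a_spec
  have := h.e_le; have := h.f_le
  omega


/-- **Double zeros of the first-tale numerator in the contour window.** On Ω, for every integer `c` with
`a − max(e,f) + 1 ≤ c < a₂*(e,f,b,a)`, two of the three numerator blocks `[1,e)`, `[a−e+1,f)`, `[a−f+1,b)` contain `c`,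
so `(X+c)² ∣ num` — i.e. `F_L(p;·)` has a double zero at `t = −c` (this is why the contour may be moved across these
points: `Pt.lam_vL_move`). -/
theorem sq_lin_dvd_num (h : p.Omega) {c : ℤ} (hlo : p.a - max p.e p.f + 1 ≤ c) (hhi : c + 1 ≤ a2star p.t1a) :
    lin c ^ 2 ∣ num p.t1a p.t1b := by
  have sp := a2star_t1a_eq h
  obtain ⟨o1, o2, o3, o4, o5, o6, o7, o8, o9⟩ := h
  have hcases : (1 ≤ c ∧ c < p.e ∧ p.a - p.e + 1 ≤ c ∧ c < p.f)
      ∨ (1 ≤ c ∧ c < p.e ∧ p.a - p.f + 1 ≤ c ∧ c < p.b)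
      ∨ (p.a - p.e + 1 ≤ c ∧ c < p.f ∧ p.a - p.f + 1 ≤ c ∧ c < p.b) := by omega
  rw [num_t1, pow_two]
  rcases hcases with ⟨a1, a2, a3, a4⟩ | ⟨a1, a2, a3, a4⟩ | ⟨a1, a2, a3, a4⟩
  · exact (mul_dvd_mul (lin_dvd_block a1 a2) (lin_dvd_block a3 a4)).mul_right _
  · exact (mul_dvd_mul (lin_dvd_block a1 a2) (lin_dvd_block a3 a4)).trans ⟨block (p.a - p.e + 1) p.f, by ring⟩
  · exact (mul_dvd_mul (lin_dvd_block a1 a2) (lin_dvd_block a3 a4)).trans ⟨block 1 p.e, by ring⟩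

/-- The second-tale index ranges at a point of the family: on Ω, `aMid(â) = max(e,f)` (median of `f,e,a`),
`aMax3(â) = a`, `bMin(b̂) = min(e+f,g)`, `bMax(b̂) = max(e+f,g)`. -/
theorem t2_ranges (h : p.Omega) : aMid p.t2a = max p.e p.f ∧ aMax3 p.t2a = p.a ∧
    bMin p.t2b = min (p.e + p.f) p.g ∧ bMax p.t2b = max (p.e + p.f) p.g := by
  have h3 := h.e_le; have h4 := h.f_le
  have e1 : p.t2a 1 = p.f := rfl
  have e2 : p.t2a 2 = p.e := rfl
  have e3 : p.t2a 3 = p.a := rfl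
  have f2 : p.t2b 2 = p.e + p.f := rfl
  have f3 : p.t2b 3 = p.g := rfl
  unfold aMid aMax3 bMin bMax
  rw [e1, e2, e3, f2, f3]
  refine ⟨?_, ?_, rfl, rfl⟩ <;> omega

/-- `â₀*(â(p)) = min(g−b+a, 2·max(e,f))` on Ω (the median of `f,e,a` is `max(e,f)` since `e,f ≤ a`). -/
theorem a0star_t2a_eq (h : p.Omega) : a0star p.t2a = min (p.g - p.b + p.a) (2 * max p.e p.f) := by
  have hm := (t2_ranges h).1
  have e0 : p.t2a 0 = p.g - p.b + p.a := rfl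
  unfold a0star
  rw [hm, e0]

end Pt

end Summit.KontsevichZagierPeriods.Zeta5Search.TwoTaleOmega

end
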